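import Summits.NavierStokesRegularity.FunctionalMining.TopEigRayleighSpectral
import Summits.NavierStokesRegularity.FunctionalMining.StrainTensorTransport
import HarnessLib

/-!
# FunctionalMining — planar shadow for the eigenvalue cores (part 5): the PLANAR TANGENT lemma —
# along a classical solution issued from planar data, `∫λ₁⁴` and `¼∫|S|⁴` have the same one-sided
# derivative at the initial time

Search for candidate a priori estimates; no regularity claim. Cell `pub-nsfunc`, prove seat
(gen 18). Kinematics/calculus only; nothing about regularity.

WHY. The C3a/C3b doors (`PlanarShadowDoor`) need a one-sided derivative VALUE of `s ↦ Φ(u s)` at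
the initial time. For `Φ = ∫|S|⁴` this is the smooth-weight balance; for the eigenvalue cores
`Φ = ∫(λ₁⁺)⁴`, `∫((−λ₃)⁺)⁴` (K0 `ES.lam1.q=4`, `ES.neglam3.q=4`) the weight `A ↦ λ(A)⁴` is NOT `C¹`
near the strain range of a planar field with strain zeros (near `A = 0` there are matrices with a
degenerate top eigenvalue), so no chain rule applies. Instead:

* `lam_planar` — on PLANAR trace-free symmetric tensors (`A(1,·) = A(·,1) = 0`, `A₀₀ + A₂₂ = 0`) the
  top Rayleigh value is explicit, `λ(A) = √(A₀₀² + A₀₂²)`, so **`λ(A)⁴ = λ(−A)⁴ = ‖A‖⁴/4`**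
  (`lam_pow_four_planar`, `lam_neg_pow_four_planar`);
* `abs_lam_pow_four_sub_le` — `A ↦ λ(±A)⁴ − ‖A‖⁴/4` is Lipschitz on balls (`λ` is 1-Lipschitz);
* **`hasDerivWithinAt_integral_lam_pow_four_of_planar`** — if along a jointly smooth tensor field
  `θ` on `[a, b] × T³` the initial slice `θ a` AND the initial time derivative `∂ₜθ(a, ·)` are planar
  trace-free symmetric, then `s ↦ ∫ λ(θ s x)⁴ dx` has at `a` the SAME one-sided derivative as
  `s ↦ ¼∫ ‖θ s x‖⁴ dx` (the segment `θ a + (s−a)∂ₜθ a` stays planar, where the two weights agree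
  exactly; the true field deviates from the segment by `o(s − a)` uniformly in `x` — tube lemma +
  mean value inequality — and both weights are Lipschitz near the range); likewise for `λ(−·)⁴`.

Part 6 (`PlanarShadowTopEigKill`): the rows `ES.lam1.q=4`, `ES.neglam3.q=4 | T_C | C3a, C3b`, every `C`.
-/

noncomputable section

open MeasureTheory Set Filter Topology

namespace Summit.NavierStokesRegularity.FunctionalMining

open Literature.Analysis Literature.Analysis.FunctionSpaces Literature.Analysis.FunctionSpaces.Torus
open TopEig

namespace PlanarTopEig

/-! ## 1. The top Rayleigh value of a planar trace-free symmetric tensor -/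

/-- A PLANAR trace-free symmetric tensor of `ℝ^{3×3}`: symmetric, the `1`-row and `1`-column vanish,
and `A₀₀ + A₂₂ = 0`. [ours; bookkeeping] -/
structure IsPlanarTF (A : EuclideanSpace ℝ (Fin 3 × Fin 3)) : Prop where
  /-- symmetry -/ symm : ∀ i j, A (i, j) = A (j, i)
  /-- the middle row vanishes -/ row : ∀ j, A (1, j) = 0
  /-- trace zero (given `A₁₁ = 0`) -/ tr : A (0, 0) + A (2, 2) = 0

namespace IsPlanarTF

variable {A : EuclideanSpace ℝ (Fin 3 × Fin 3)}

/-- The middle column vanishes too. [ours; bookkeeping] -/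
theorem col (h : IsPlanarTF A) (j : Fin 3) : A (j, 1) = 0 := by rw [h.symm]; exact h.row j

/-- Planarity is preserved by negation. [ours; bookkeeping] -/
theorem neg (h : IsPlanarTF A) : IsPlanarTF (-A) where
  symm i j := by simp [h.symm i j]
  row j := by simp [h.row j]
  tr := by simp only [PiLp.neg_apply]; linarith [h.tr]

/-- Planarity is preserved along segments. [ours; bookkeeping] -/
theorem add_smul (h : IsPlanarTF A) {B : EuclideanSpace ℝ (Fin 3 × Fin 3)} (hB : IsPlanarTF B) (s : ℝ) :
    IsPlanarTF (A + s • B) where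
  symm i j := by simp [h.symm i j, hB.symm i j]
  row j := by simp [h.row j, hB.row j]
  tr := by simp only [PiLp.add_apply, PiLp.smul_apply, smul_eq_mul]; linear_combination h.tr + s * hB.tr

/-- The quadratic form of a planar trace-free tensor: `eᵀAe = a(e₀² − e₂²) + 2b e₀e₂`. [ours] -/
theorem quad_eq (h : IsPlanarTF A) (e : Fin 3 → ℝ) :
    quad A e = A (0, 0) * (e 0 ^ 2 - e 2 ^ 2) + 2 * A (0, 2) * (e 0 * e 2) := by
  have h22 : A (2, 2) = -A (0, 0) := by linarith [h.tr]
  simp only [quad, Fin.sum_univ_three, h.row, h.col, h22, h.symm 2 0]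
  ring

/-- The squared norm of a planar trace-free tensor: `‖A‖² = 2(a² + b²)`. [ours] -/
theorem norm_sq_eq (h : IsPlanarTF A) : ‖A‖ ^ 2 = 2 * (A (0, 0) ^ 2 + A (0, 2) ^ 2) := by
  have h22 : A (2, 2) = -A (0, 0) := by linarith [h.tr]
  rw [EuclideanCoord.norm_sq_eq_sum_sq, Fintype.sum_prod_type]
  simp only [Fin.sum_univ_three, h.row, h.col, h22, h.symm 2 0]
  ring

/-- **`λ(A) = √(a² + b²)` for a planar trace-free tensor.** [ours] -/
theorem lam_eq (h : IsPlanarTF A) : lam A = Real.sqrt (A (0, 0) ^ 2 + A (0, 2) ^ 2) := by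
  set a := A (0, 0) with ha
  set b := A (0, 2) with hb
  set s := Real.sqrt (a ^ 2 + b ^ 2) with hs
  have hs0 : 0 ≤ s := Real.sqrt_nonneg _
  have hs2 : s ^ 2 = a ^ 2 + b ^ 2 := Real.sq_sqrt (by positivity)
  apply le_antisymm
  · -- upper bound: Cauchy–Schwarz in the `(e₀, e₂)`-plane
    refine lam_le fun e he => ?_
    rw [h.quad_eq e]
    have hr : e 0 ^ 2 + e 2 ^ 2 ≤ 1 := by
      have : e ⬝ᵥ e = e 0 ^ 2 + e 1 ^ 2 + e 2 ^ 2 := by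
        simp [dotProduct, Fin.sum_univ_three, sq]
      nlinarith [sq_nonneg (e 1)]
    have hr0 : 0 ≤ e 0 ^ 2 + e 2 ^ 2 := by positivity
    -- `(a u + b v)² ≤ (a²+b²)(u²+v²) = s² r²` with `u = e₀²−e₂²`, `v = 2e₀e₂`, `u²+v² = r²`
    have key : (a * (e 0 ^ 2 - e 2 ^ 2) + 2 * b * (e 0 * e 2)) ^ 2 ≤ (s * (e 0 ^ 2 + e 2 ^ 2)) ^ 2 := by
      rw [mul_pow, hs2]
      nlinarith [sq_nonneg (a * (2 * (e 0 * e 2)) - b * (e 0 ^ 2 - e 2 ^ 2))]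
    have h1 : a * (e 0 ^ 2 - e 2 ^ 2) + 2 * b * (e 0 * e 2) ≤ s * (e 0 ^ 2 + e 2 ^ 2) :=
      (abs_le_of_sq_le_sq' key (by positivity)).2
    calc a * (e 0 ^ 2 - e 2 ^ 2) + 2 * b * (e 0 * e 2) ≤ s * (e 0 ^ 2 + e 2 ^ 2) := h1
      _ ≤ s * 1 := mul_le_mul_of_nonneg_left hr hs0
      _ = s := mul_one s
  · -- lower bound: an explicit unit vector attaining `s`
    by_cases hpos : 0 < s + a
    · -- `f = (a + s, 0, b)`, `|f|² = 2s(s+a)`, `fᵀAf = 2s²(s+a)`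
      have hspos : 0 < s := by
        rcases hs0.lt_or_eq with hlt | heq
        · exact hlt
        · exfalso
          have hab : a ^ 2 + b ^ 2 = 0 := by rw [← hs2, ← heq]; ring
          have ha0 : a = 0 := by nlinarith [sq_nonneg a, sq_nonneg b]
          rw [← heq, ha0, add_zero] at hpos
          exact lt_irrefl _ hpos
      set r := Real.sqrt (2 * s * (s + a)) with hr
      have h2pos : 0 < 2 * s * (s + a) := by positivity
      have hr0 : 0 < r := Real.sqrt_pos.2 h2pos
      have hr2 : r ^ 2 = 2 * s * (s + a) := Real.sq_sqrt h2pos.le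
      set e : Fin 3 → ℝ := ![(a + s) / r, 0, b / r] with he
      have hunit : e ⬝ᵥ e = 1 := by
        simp only [dotProduct, Fin.sum_univ_three, he, Matrix.cons_val_zero, Matrix.cons_val_one,
          Matrix.cons_val]
        field_simp
        nlinarith [hs2, hr2]
      have hq : quad A e = s := by
        rw [h.quad_eq e]
        simp only [he, Matrix.cons_val_zero, Matrix.cons_val]
        field_simp
        nlinarith [hs2, hr2, hr0]
      exact hq ▸ quad_le_lam A hunit
    · -- `s + a = 0`: then `b = 0`, `a = −s` and `e₂` attains `A₂₂ = s`
      have hsa : s + a = 0 := by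
        have : -a ≤ s := by
          rw [hs]; calc -a ≤ |a| := neg_le_abs a
            _ = Real.sqrt (a ^ 2) := (Real.sqrt_sq_eq_abs a).symm
            _ ≤ Real.sqrt (a ^ 2 + b ^ 2) := Real.sqrt_le_sqrt (by nlinarith [sq_nonneg b])
        linarith [not_lt.mp hpos]
      have h22 : A (2, 2) = s := by linarith [h.tr]
      have hq : quad A (Pi.single 2 1) = s := by rw [quad_single]; exact h22
      exact hq ▸ quad_le_lam A (single_mem_unitSphere 2)

/-- **`λ(A)⁴ = ‖A‖⁴/4` for a planar trace-free tensor.** [ours] -/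
theorem lam_pow_four (h : IsPlanarTF A) : lam A ^ 4 = (‖A‖ ^ 2) ^ 2 / 4 := by
  rw [h.lam_eq, h.norm_sq_eq, show (4 : ℕ) = 2 * 2 from rfl, pow_mul, Real.sq_sqrt (by positivity)]
  ring

/-- **`λ(−A)⁴ = ‖A‖⁴/4`** as well (the `−λ₃` core). [ours] -/
theorem lam_neg_pow_four (h : IsPlanarTF A) : lam (-A) ^ 4 = (‖A‖ ^ 2) ^ 2 / 4 := by
  rw [h.neg.lam_pow_four, norm_neg]

end IsPlanarTF

/-! ## 2. Lipschitz control of the two weights on balls -/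
/-- `|λ(A)⁴ − λ(B)⁴| ≤ 4R³‖A − B‖` on the ball of radius `R`. [ours] -/
theorem abs_lam_pow_four_sub_le {A B : EuclideanSpace ℝ (Fin 3 × Fin 3)} {R : ℝ}
    (hA : ‖A‖ ≤ R) (hB : ‖B‖ ≤ R) : |lam A ^ 4 - lam B ^ 4| ≤ 4 * R ^ 3 * ‖A - B‖ := by
  have hR : 0 ≤ R := (norm_nonneg A).trans hA
  have hlA : |lam A| ≤ R := (abs_lam_le_norm A).trans hA
  have hlB : |lam B| ≤ R := (abs_lam_le_norm B).trans hB
  have hd : |lam A - lam B| ≤ ‖A - B‖ := abs_lam_sub_lam_le A B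
  have e : lam A ^ 4 - lam B ^ 4 =
      (lam A - lam B) * (lam A ^ 3 + lam A ^ 2 * lam B + lam A * lam B ^ 2 + lam B ^ 3) := by ring
  rw [e, abs_mul]
  have h2 : |lam A ^ 3 + lam A ^ 2 * lam B + lam A * lam B ^ 2 + lam B ^ 3| ≤ 4 * R ^ 3 := by
    have a3 : |lam A| ^ 3 ≤ R ^ 3 := by gcongr
    have b3 : |lam B| ^ 3 ≤ R ^ 3 := by gcongr
    have a2b : |lam A| ^ 2 * |lam B| ≤ R ^ 2 * R := by gcongr
    have ab2 : |lam A| * |lam B| ^ 2 ≤ R * R ^ 2 := by gcongr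
    calc |lam A ^ 3 + lam A ^ 2 * lam B + lam A * lam B ^ 2 + lam B ^ 3|
        ≤ |lam A ^ 3| + |lam A ^ 2 * lam B| + |lam A * lam B ^ 2| + |lam B ^ 3| := by
          refine (abs_add_le _ _).trans (add_le_add ((abs_add_le _ _).trans (add_le_add (abs_add_le _ _) le_rfl)) le_rfl)
      _ = |lam A| ^ 3 + |lam A| ^ 2 * |lam B| + |lam A| * |lam B| ^ 2 + |lam B| ^ 3 := by
          simp [abs_mul, abs_pow]
      _ ≤ R ^ 3 + R ^ 2 * R + R * R ^ 2 + R ^ 3 := by gcongr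
      _ = 4 * R ^ 3 := by ring
  calc |lam A - lam B| * |lam A ^ 3 + lam A ^ 2 * lam B + lam A * lam B ^ 2 + lam B ^ 3|
      ≤ ‖A - B‖ * (4 * R ^ 3) := mul_le_mul hd h2 (abs_nonneg _) (norm_nonneg _)
    _ = 4 * R ^ 3 * ‖A - B‖ := by ring

/-- `|‖A‖⁴ − ‖B‖⁴| ≤ 4R³‖A − B‖` on the ball of radius `R`. [ours] -/
theorem abs_norm_pow_four_sub_le {E : Type*} [NormedAddCommGroup E] {A B : E} {R : ℝ}
    (hA : ‖A‖ ≤ R) (hB : ‖B‖ ≤ R) : |(‖A‖ ^ 2) ^ 2 - (‖B‖ ^ 2) ^ 2| ≤ 4 * R ^ 3 * ‖A - B‖ := by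
  have hR : 0 ≤ R := (norm_nonneg A).trans hA
  have hd : |‖A‖ - ‖B‖| ≤ ‖A - B‖ := abs_norm_sub_norm_le A B
  have e : (‖A‖ ^ 2) ^ 2 - (‖B‖ ^ 2) ^ 2 =
      (‖A‖ - ‖B‖) * (‖A‖ ^ 3 + ‖A‖ ^ 2 * ‖B‖ + ‖A‖ * ‖B‖ ^ 2 + ‖B‖ ^ 3) := by ring
  rw [e, abs_mul]
  have hpos : 0 ≤ ‖A‖ ^ 3 + ‖A‖ ^ 2 * ‖B‖ + ‖A‖ * ‖B‖ ^ 2 + ‖B‖ ^ 3 := by positivity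
  rw [abs_of_nonneg hpos]
  have h2 : ‖A‖ ^ 3 + ‖A‖ ^ 2 * ‖B‖ + ‖A‖ * ‖B‖ ^ 2 + ‖B‖ ^ 3 ≤ 4 * R ^ 3 := by
    have a3 : ‖A‖ ^ 3 ≤ R ^ 3 := by gcongr
    have b3 : ‖B‖ ^ 3 ≤ R ^ 3 := by gcongr
    have a2b : ‖A‖ ^ 2 * ‖B‖ ≤ R ^ 2 * R := by gcongr
    have ab2 : ‖A‖ * ‖B‖ ^ 2 ≤ R * R ^ 2 := by gcongr
    nlinarith
  calc |‖A‖ - ‖B‖| * (‖A‖ ^ 3 + ‖A‖ ^ 2 * ‖B‖ + ‖A‖ * ‖B‖ ^ 2 + ‖B‖ ^ 3)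
      ≤ ‖A - B‖ * (4 * R ^ 3) := mul_le_mul hd h2 hpos (norm_nonneg _)
    _ = 4 * R ^ 3 * ‖A - B‖ := by ring

/-! ## 3. The planar tangent lemma: derivative transfer at the initial time -/

/-- Uniform first-order Taylor estimate in time, uniformly in space: for a jointly smooth field on
`[a, b] × T^d` and `ε > 0`, for `s ∈ [a, b]` near `a`,
`‖θ(s, x) − θ(a, x) − (s − a)∂ₜθ(a, x)‖ ≤ ε (s − a)` for all `x` (tube lemma for `∂ₜθ` + mean value
inequality on `[a, s]`). [folklore] -/
theorem eventually_norm_taylor_le {F : Type*} [NormedAddCommGroup F] [NormedSpace ℝ F] {d : Type*}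
    [Fintype d] {a b : ℝ} (hab : a < b) {θ : ℝ → UnitAddTorus d → F}
    (hθ : Torus.IsSmoothSpaceTimeOn (Icc a b) θ) {ε : ℝ} (hε : 0 < ε) :
    ∀ᶠ s in 𝓝[Icc a b] a, ∀ x,
      ‖θ s x - θ a x - (s - a) • Torus.timeDerivWithin (Icc a b) θ a x‖ ≤ ε * (s - a) := by
  have hU : UniqueDiffOn ℝ (Icc a b) := uniqueDiffOn_Icc hab
  have ha : a ∈ Icc a b := left_mem_Icc.2 hab.le
  obtain ⟨δ, hδ, hball⟩ := Metric.mem_nhdsWithin_iff.1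
    (hθ.eventually_norm_timeDerivWithin_sub_lt hU ha hε)
  have hS : ∀ᶠ s in 𝓝[Icc a b] a, s ∈ Icc a b ∧ dist s a < δ := by
    filter_upwards [self_mem_nhdsWithin, nhdsWithin_le_nhds (Metric.ball_mem_nhds a hδ)]
      with s hs hsd
    exact ⟨hs, hsd⟩
  filter_upwards [hS] with s hs x
  obtain ⟨hs, hsd⟩ := hs
  set θ' := Torus.timeDerivWithin (Icc a b) θ a x with hθ'
  have hderiv : ∀ σ ∈ Icc a s, HasDerivWithinAt (fun τ => θ τ x - (τ - a) • θ')
      (Torus.timeDerivWithin (Icc a b) θ σ x - (1 : ℝ) • θ') (Icc a s) σ := by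
    intro σ hσ
    have hσS : σ ∈ Icc a b := ⟨hσ.1, hσ.2.trans hs.2⟩
    have h1 : HasDerivWithinAt (fun τ => θ τ x) (Torus.timeDerivWithin (Icc a b) θ σ x) (Icc a s) σ :=
      (hθ.hasDerivWithinAt_slice hσS x).mono (Icc_subset_Icc_right hs.2)
    have h2 : HasDerivWithinAt (fun τ : ℝ => (τ - a) • θ') ((1 : ℝ) • θ') (Icc a s) σ :=
      ((hasDerivAt_id σ).sub_const a).hasDerivWithinAt.smul_const θ'
    exact h1.sub h2
  have hbound : ∀ σ ∈ Ico a s, ‖Torus.timeDerivWithin (Icc a b) θ σ x - (1 : ℝ) • θ'‖ ≤ ε := by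
    intro σ hσ
    have hσS : σ ∈ Icc a b := ⟨hσ.1, hσ.2.le.trans hs.2⟩
    have hσd : dist σ a < δ := by
      rw [Real.dist_eq, abs_of_nonneg (by linarith [hσ.1])]
      rw [Real.dist_eq, abs_of_nonneg (by linarith [hs.1])] at hsd
      linarith [hσ.2]
    have := hball ⟨hσd, hσS⟩ x
    rw [one_smul]
    exact this.le
  have h := norm_image_sub_le_of_norm_deriv_le_segment' hderiv hbound s (right_mem_Icc.2 hs.1)
  have e : θ s x - θ a x - (s - a) • θ' = θ s x - (s - a) • θ' - (θ a x - (a - a) • θ') := by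
    rw [sub_self, zero_smul, sub_zero]; abel
  rw [e]; exact h

/-- **The planar tangent lemma.** Let `θ` be jointly smooth on `[a, b] × T³` with values in `ℝ^{3×3}`,
with PLANAR trace-free symmetric initial slice `θ(a, ·)` and initial time derivative `∂ₜθ(a, ·)`. Let
`g : ℝ^{3×3} → ℝ` be continuous, equal to `‖·‖⁴/4` on planar trace-free symmetric tensors, and
`4R³`-Lipschitz on every ball of radius `R` (both eigenvalue weights `λ(·)⁴`, `λ(−·)⁴` qualify). Then
`s ↦ ∫ g(θ(s, x)) dx` has at `a` the same one-sided derivative within `[a, b]` as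
`s ↦ ∫ ‖θ(s, x)‖⁴/4 dx`. [ours] -/
theorem hasDerivWithinAt_integral_of_planar_tangent {a b : ℝ} (hab : a < b)
    {θ : ℝ → UnitAddTorus (Fin 3) → EuclideanSpace ℝ (Fin 3 × Fin 3)}
    (hθ : Torus.IsSmoothSpaceTimeOn (Icc a b) θ)
    (h0 : ∀ x, IsPlanarTF (θ a x)) (h1 : ∀ x, IsPlanarTF (Torus.timeDerivWithin (Icc a b) θ a x))
    {g : EuclideanSpace ℝ (Fin 3 × Fin 3) → ℝ} (hgc : Continuous g)
    (hg_planar : ∀ A, IsPlanarTF A → g A = (‖A‖ ^ 2) ^ 2 / 4)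
    (hg_lip : ∀ R : ℝ, ∀ A B, ‖A‖ ≤ R → ‖B‖ ≤ R → |g A - g B| ≤ 4 * R ^ 3 * ‖A - B‖)
    {D : ℝ} (hD : HasDerivWithinAt (fun s => ∫ x, (‖θ s x‖ ^ 2) ^ 2 / 4) D (Icc a b) a) :
    HasDerivWithinAt (fun s => ∫ x, g (θ s x)) D (Icc a b) a := by
  have hU : UniqueDiffOn ℝ (Icc a b) := uniqueDiffOn_Icc hab
  have ha : a ∈ Icc a b := left_mem_Icc.2 hab.le
  set θ' := Torus.timeDerivWithin (Icc a b) θ a with hθ'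
  -- bounds at the initial time
  have hθac : Continuous (θ a) := (hθ.isSmooth_slice ha).continuous
  have hθ'c : Continuous θ' := (hθ.isSmooth_timeDerivWithin hU ha).continuous
  obtain ⟨R₀, hR₀⟩ : ∃ R₀ : ℝ, ∀ x, ‖θ a x‖ ≤ R₀ := by
    obtain ⟨M, hM⟩ := isCompact_univ.exists_bound_of_continuousOn hθac.continuousOn
    exact ⟨M, fun x => hM x (mem_univ x)⟩
  obtain ⟨M, hM⟩ : ∃ M : ℝ, ∀ x, ‖θ' x‖ ≤ M := by
    obtain ⟨M, hM⟩ := isCompact_univ.exists_bound_of_continuousOn hθ'c.continuousOn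
    exact ⟨M, fun x => hM x (mem_univ x)⟩
  have hR₀0 : 0 ≤ R₀ := (norm_nonneg _).trans (hR₀ 0)
  have hM0 : 0 ≤ M := (norm_nonneg _).trans (hM 0)
  set R : ℝ := R₀ + 1 + (b - a) * M with hR
  have hRpos : 0 ≤ R := by rw [hR]; nlinarith [hab.le]
  -- the two integral functionals agree at `a`
  set G₂ : ℝ → ℝ := fun s => ∫ x, (‖θ s x‖ ^ 2) ^ 2 / 4 with hG₂
  set G : ℝ → ℝ := fun s => ∫ x, g (θ s x) with hG
  have hGa : G a = G₂ a := by
    simp only [hG, hG₂]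
    exact integral_congr_ae (ae_of_all _ fun x => hg_planar _ (h0 x))
  -- `G s − G₂ s = o(s − a)`
  have hsmall : ∀ ε : ℝ, 0 < ε → ∀ᶠ s in 𝓝[Icc a b] a, |G s - G₂ s| ≤ (5 * R ^ 3 * ε) * (s - a) := by
    intro ε hε
    filter_upwards [eventually_norm_taylor_le hab hθ hε, hθ.eventually_norm_sub_lt ha one_pos,
      self_mem_nhdsWithin] with s htay hnear hs
    have hsa : 0 ≤ s - a := by linarith [hs.1]
    -- pointwise estimate
    have hpt : ∀ x, |g (θ s x) - (‖θ s x‖ ^ 2) ^ 2 / 4| ≤ (5 * R ^ 3 * ε) * (s - a) := by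
      intro x
      set P := θ a x + (s - a) • θ' x with hP
      have hPpl : IsPlanarTF P := (h0 x).add_smul (h1 x) (s - a)
      have hθs : ‖θ s x‖ ≤ R := by
        have := hnear x
        calc ‖θ s x‖ ≤ ‖θ a x‖ + ‖θ s x - θ a x‖ := norm_le_norm_add_norm_sub' _ _
          _ ≤ R₀ + 1 := add_le_add (hR₀ x) this.le
          _ ≤ R := by rw [hR]; nlinarith [hab.le]
      have hPn : ‖P‖ ≤ R := by
        calc ‖P‖ ≤ ‖θ a x‖ + ‖(s - a) • θ' x‖ := norm_add_le _ _
          _ ≤ R₀ + (b - a) * M := by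
              rw [norm_smul, Real.norm_eq_abs, abs_of_nonneg hsa]
              exact add_le_add (hR₀ x) (mul_le_mul (by linarith [hs.2]) (hM x) (norm_nonneg _)
                (by linarith [hab.le]))
          _ ≤ R := by rw [hR]; linarith
      have hdist : ‖θ s x - P‖ ≤ ε * (s - a) := by
        have := htay x; rwa [hP, ← sub_sub]
      have e1 : |g (θ s x) - g P| ≤ 4 * R ^ 3 * ‖θ s x - P‖ := hg_lip R _ _ hθs hPn
      have e2 : |(‖P‖ ^ 2) ^ 2 - (‖θ s x‖ ^ 2) ^ 2| ≤ 4 * R ^ 3 * ‖P - θ s x‖ :=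
        abs_norm_pow_four_sub_le hPn hθs
      rw [norm_sub_rev] at e2
      have hgP : g P = (‖P‖ ^ 2) ^ 2 / 4 := hg_planar P hPpl
      have e3 : |g (θ s x) - (‖θ s x‖ ^ 2) ^ 2 / 4| ≤
          |g (θ s x) - g P| + |(‖P‖ ^ 2) ^ 2 - (‖θ s x‖ ^ 2) ^ 2| / 4 := by
        have : g (θ s x) - (‖θ s x‖ ^ 2) ^ 2 / 4 =
            (g (θ s x) - g P) + ((‖P‖ ^ 2) ^ 2 - (‖θ s x‖ ^ 2) ^ 2) / 4 := by rw [hgP]; ring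
        rw [this]
        refine (abs_add_le _ _).trans (add_le_add le_rfl ?_)
        rw [abs_div, abs_of_pos (by norm_num : (0:ℝ) < 4)]
      have hR3 : 0 ≤ R ^ 3 := by positivity
      calc |g (θ s x) - (‖θ s x‖ ^ 2) ^ 2 / 4|
          ≤ 4 * R ^ 3 * ‖θ s x - P‖ + (4 * R ^ 3 * ‖θ s x - P‖) / 4 := e3.trans (by gcongr)
        _ = 5 * R ^ 3 * ‖θ s x - P‖ := by ring
        _ ≤ 5 * R ^ 3 * (ε * (s - a)) := by gcongr
        _ = (5 * R ^ 3 * ε) * (s - a) := by ring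
    -- integrate over the probability space `T³`
    have hi1 : Integrable (fun x => g (θ s x)) :=
      (hgc.comp (hθ.isSmooth_slice hs).continuous).integrable_unitAddTorus
    have hi2 : Integrable (fun x => (‖θ s x‖ ^ 2) ^ 2 / 4) :=
      ((((hθ.isSmooth_slice hs).continuous.norm.pow 2).pow 2).div_const 4).integrable_unitAddTorus
    have hsub : G s - G₂ s = ∫ x, (g (θ s x) - (‖θ s x‖ ^ 2) ^ 2 / 4) := by
      simp only [hG, hG₂]; rw [integral_sub hi1 hi2]
    rw [hsub]
    have := norm_integral_le_of_norm_le_const (μ := (volume : Measure (UnitAddTorus (Fin 3))))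
      (f := fun x => g (θ s x) - (‖θ s x‖ ^ 2) ^ 2 / 4) (C := (5 * R ^ 3 * ε) * (s - a))
      (ae_of_all _ fun x => by rw [Real.norm_eq_abs]; exact hpt x)
    simpa [Real.norm_eq_abs] using this
  -- conclude by little-o bookkeeping
  rw [hasDerivWithinAt_iff_isLittleO] at hD ⊢
  have hdiff : (fun s => G s - G₂ s) =o[𝓝[Icc a b] a] fun s => s - a := by
    refine Asymptotics.isLittleO_iff.2 fun c hc => ?_
    have hR3 : 0 < 5 * R ^ 3 + 1 := by positivity
    have hε : 0 < c / (5 * R ^ 3 + 1) := div_pos hc hR3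
    filter_upwards [hsmall _ hε, self_mem_nhdsWithin] with s hs hsS
    have hsa : 0 ≤ s - a := by linarith [hsS.1]
    rw [Real.norm_eq_abs, Real.norm_eq_abs, abs_of_nonneg hsa]
    refine hs.trans ?_
    have : 5 * R ^ 3 * (c / (5 * R ^ 3 + 1)) ≤ c := by
      rw [mul_div_assoc']
      rw [div_le_iff₀ hR3]
      nlinarith [hc, hRpos, pow_nonneg hRpos 3]
    exact mul_le_mul_of_nonneg_right this hsa
  have hsum := hdiff.add hD
  refine hsum.congr' ?_ (Eventually.of_forall fun _ => rfl)
  filter_upwards with s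
  simp only [hG, hG₂, smul_eq_mul] at hGa ⊢
  show (∫ x, g (θ s x)) - (∫ x, (‖θ s x‖ ^ 2) ^ 2 / 4) +
      ((∫ x, (‖θ s x‖ ^ 2) ^ 2 / 4) - (∫ x, (‖θ a x‖ ^ 2) ^ 2 / 4) - (s - a) * D) =
    (∫ x, g (θ s x)) - (∫ x, g (θ a x)) - (s - a) * D
  rw [hGa]; ring

/-- The planar tangent lemma for the `λ₁` weight `g = λ(·)⁴`. [ours] -/
theorem hasDerivWithinAt_integral_lam_pow_four {a b : ℝ} (hab : a < b)
    {θ : ℝ → UnitAddTorus (Fin 3) → EuclideanSpace ℝ (Fin 3 × Fin 3)}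
    (hθ : Torus.IsSmoothSpaceTimeOn (Icc a b) θ)
    (h0 : ∀ x, IsPlanarTF (θ a x)) (h1 : ∀ x, IsPlanarTF (Torus.timeDerivWithin (Icc a b) θ a x))
    {D : ℝ} (hD : HasDerivWithinAt (fun s => ∫ x, (‖θ s x‖ ^ 2) ^ 2 / 4) D (Icc a b) a) :
    HasDerivWithinAt (fun s => ∫ x, lam (θ s x) ^ 4) D (Icc a b) a :=
  hasDerivWithinAt_integral_of_planar_tangent hab hθ h0 h1 (g := fun A => lam A ^ 4)
    (continuous_lam.pow 4) (fun _ hA => hA.lam_pow_four)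
    (fun _ _ _ hA hB => abs_lam_pow_four_sub_le hA hB) hD

/-- The planar tangent lemma for the `−λ₃` weight `g = λ(−·)⁴`. [ours] -/
theorem hasDerivWithinAt_integral_lam_neg_pow_four {a b : ℝ} (hab : a < b)
    {θ : ℝ → UnitAddTorus (Fin 3) → EuclideanSpace ℝ (Fin 3 × Fin 3)}
    (hθ : Torus.IsSmoothSpaceTimeOn (Icc a b) θ)
    (h0 : ∀ x, IsPlanarTF (θ a x)) (h1 : ∀ x, IsPlanarTF (Torus.timeDerivWithin (Icc a b) θ a x))
    {D : ℝ} (hD : HasDerivWithinAt (fun s => ∫ x, (‖θ s x‖ ^ 2) ^ 2 / 4) D (Icc a b) a) :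
    HasDerivWithinAt (fun s => ∫ x, lam (-θ s x) ^ 4) D (Icc a b) a :=
  hasDerivWithinAt_integral_of_planar_tangent hab hθ h0 h1 (g := fun A => lam (-A) ^ 4)
    ((continuous_lam.comp continuous_neg).pow 4) (fun _ hA => hA.lam_neg_pow_four)
    (fun R A B hA hB => by
      have h := abs_lam_pow_four_sub_le (A := -A) (B := -B) (R := R) (by rwa [norm_neg])
        (by rwa [norm_neg])
      rwa [neg_sub_neg, norm_sub_rev] at h) hD
end PlanarTopEig

end Summit.NavierStokesRegularity.FunctionalMining

end
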